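import Mathlib
import HarnessLib
import Literature.NumberTheory.Transcendental.Associators
import Literature.NumberTheory.Transcendental.AssociatorsProofs

/-!
# `KernelModuloPeriodConjecture`, line `Sketch`: the shuffle product in depth `1 × 1`

Crux `FurushoPentagon.KernelModuloPeriodConjecture` (stmt-KontsevichZagierPeriods-15058), line
`Sketch`, registered stub `stub_shuffleDepthOne` (stub (i) of skeleton v8: the infinite depth-one
even family `s = (2n)` of the algebraic leaf). For a group-like series `φ ∈ R⟨⟨x₀, x₁⟩⟩`
(`NCSeries.IsGroupLike φ`: the shuffle relations `c_u(φ) c_v(φ) = Σ_{w ∈ u ш v} c_w(φ)`), the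
product of two depth-one coefficients is **Euler's decomposition formula**

  `c_{(a)} c_{(b)} = Σ_{i<a} C(b-1+i, i) c_{(b+i, a-i)} + Σ_{j<b} C(a-1+j, j) c_{(a+j, b-j)}`
  (`a, b ≥ 1`),

i.e. the shuffle product `x₀^{a-1}x₁ ш x₀^{b-1}x₁` counted with binomial multiplicities: the
interleavings ending with the letter `x₁` of the first word are the words
`x₀^{b-1+i} x₁ x₀^{a-1-i} x₁` (`i < a`), each obtained `C(b-1+i, i)` times (the positions of the
`i` leading zeros of the first word among the first `b-1+i` letters), and symmetrically. At
`φ = Φ_KZ` and `a, b ≥ 2` this is Euler's decomposition theorem `ζ(a)ζ(b) = Σ …` (Eie 2013,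
Theorem 1.2.3; tree theorem `multipleZeta_mul_eq_euler_decomposition` for real multiple zeta
values); for abstract group-like series it is the shuffle half of the depth-two double-shuffle
system of Gangl–Kaneko–Zagier and Ihara–Kaneko–Zagier (2006), §2.

The proof is the finite combinatorial induction behind `tsum_tornheim_eq_sum_binomial`
(`Literature/NumberTheory/Transcendental/MultipleZetaEulerDecompositionProofs.lean`): peeling a
leading `x₀` off either word by the recursion `(x₀u) ш (x₀v) = x₀(u ш x₀v) + x₀(x₀u ш v)`
(`MZV.shuffleWord_cons_cons`) and reassembling the multiplicities by Pascal's rule; the sums are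
organised over the antidiagonal `{(i, k) | i + k = p}` (`Finset.HasAntidiagonal.antidiagonal`, no
truncated subtraction) and converted to the registered `Finset.range` form at the end.

References: K. Ihara, M. Kaneko, D. Zagier, *Derivation and double shuffle relations for multiple
zeta values*, Compos. Math. 142 (2006), §2 [IharaKanekoZagier2006]; M. Eie, *The Theory of
Multiple Zeta Values with Applications in Combinatorics* (2013), Theorem 1.2.3 [Eie2013];
C. Reutenauer, *Free Lie Algebras* (1993), §1.4 [Reutenauer1993].
-/

namespace Summit.KontsevichZagierPeriods.FurushoPentagon.KernelModuloPeriodConjecture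

open Literature.NumberTheory.Transcendental
open scoped BigOperators
open Finset.HasAntidiagonal (antidiagonal)

/-- Moving a letter across a block of the same letter:
`aⁿ (a w) = a (aⁿ w)` for `a = x₀`. [folklore] -/
theorem shuffleDepthOne_replicate_append_cons (n : ℕ) (l : List Bool) :
    List.replicate n false ++ false :: l = false :: (List.replicate n false ++ l) := by
  induction n with
  | zero => rfl
  | succ n ih => simp only [List.replicate_succ, List.cons_append, ih]

/-- **Pascal reassembly** of the binomial multiplicities in Euler's decomposition: for any
family `u` indexed by the antidiagonal,
`Σ_{i+k=p} C(q+1+i, i) u_{i+1,k} + Σ_{i+k=p+1} C(q+i, i) u_{i,k} = Σ_{i+k=p+1} C(q+1+i, i) u_{i,k}`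
(Pascal's rule `C(q+2+i, i+1) = C(q+1+i, i) + C(q+1+i, i+1)`). [folklore] -/
theorem shuffleDepthOne_pascal {R : Type*} [CommRing R] (u : ℕ × ℕ → R) (p q : ℕ) :
    ∑ x ∈ antidiagonal p, ((q + 1 + x.1).choose x.1 : R) * u (x.1 + 1, x.2) +
        ∑ x ∈ antidiagonal (p + 1), ((q + x.1).choose x.1 : R) * u x =
      ∑ x ∈ antidiagonal (p + 1), ((q + 1 + x.1).choose x.1 : R) * u x := by
  rw [Finset.Nat.sum_antidiagonal_succ, Finset.Nat.sum_antidiagonal_succ]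
  have key : ∀ i : ℕ, ((q + 1 + (i + 1)).choose (i + 1) : R) =
      ((q + 1 + i).choose i : R) + ((q + (i + 1)).choose (i + 1) : R) := fun i => by
    rw [show q + 1 + (i + 1) = (q + 1 + i) + 1 by omega, Nat.choose_succ_succ', Nat.cast_add,
      show q + (i + 1) = q + 1 + i by omega]
  simp only [key, add_mul, Finset.sum_add_distrib, add_zero, Nat.choose_zero_right, Nat.cast_one,
    one_mul]
  ring

/-- **The shuffle product `x₀ᵖx₁ ш x₀^q x₁` with multiplicities** (Euler's decomposition at the
level of words): summing any `f` over the interleavings of `x₀ᵖ x₁` and `x₀^q x₁` gives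
`Σ_{i+k=p} C(q+i, i) f(x₀^{i+q} x₁ x₀ᵏ x₁) + Σ_{j+k=q} C(p+j, j) f(x₀^{j+p} x₁ x₀ᵏ x₁)`, by
induction on `p + q` from `(x₀u) ш (x₀v) = x₀(u ш x₀v) + x₀(x₀u ш v)` and Pascal's rule.
[cite: Eie2013, Theorem 1.2.3] -/
theorem shuffleDepthOne_sum_map_shuffleWord {R : Type*} [CommRing R] :
    ∀ (n : ℕ) (f : List Bool → R) (p q : ℕ), p + q = n →
      ((MZV.shuffleWord (List.replicate p false ++ [true])
          (List.replicate q false ++ [true])).map f).sum =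
        ∑ x ∈ antidiagonal p, ((q + x.1).choose x.1 : R) *
            f (List.replicate x.1 false ++
              (List.replicate q false ++ true :: (List.replicate x.2 false ++ [true]))) +
          ∑ y ∈ antidiagonal q, ((p + y.1).choose y.1 : R) *
            f (List.replicate y.1 false ++
              (List.replicate p false ++ true :: (List.replicate y.2 false ++ [true])))
  | 0, f, 0, 0, _ => by simp
  | 0, _, 0, _ + 1, h => by omega
  | 0, _, _ + 1, _, h => by omega
  | _ + 1, _, 0, 0, h => by omega
  | n + 1, f, 0, q + 1, h => by
      -- `x₁ ш x₀(x₀^q x₁) = x₁x₀^{q+1}x₁ + x₀ (x₁ ш x₀^q x₁)`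
      have hsplit : MZV.shuffleWord (List.replicate 0 false ++ [true])
          (List.replicate (q + 1) false ++ [true]) =
          [true :: (List.replicate (q + 1) false ++ [true])] ++
            (MZV.shuffleWord (List.replicate 0 false ++ [true])
              (List.replicate q false ++ [true])).map (List.cons false) := rfl
      rw [hsplit, List.map_append, List.sum_append, List.map_map,
        shuffleDepthOne_sum_map_shuffleWord n (f ∘ List.cons false) 0 q (by omega),
        Finset.Nat.sum_antidiagonal_succ]
      simp only [List.map_cons, List.map_nil, List.sum_cons, List.sum_nil, add_zero,
        Finset.Nat.antidiagonal_zero, Finset.sum_singleton, zero_add, Nat.choose_zero_right,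
        Nat.choose_self, Nat.cast_one, one_mul, Function.comp_apply, List.replicate_zero,
        List.replicate_succ, List.nil_append, List.cons_append]
      ring
  | n + 1, f, p + 1, 0, h => by
      -- `x₀(x₀ᵖ x₁) ш x₁ = x₀ (x₀ᵖx₁ ш x₁) + x₁x₀^{p+1}x₁`
      have hsplit : MZV.shuffleWord (List.replicate (p + 1) false ++ [true])
          (List.replicate 0 false ++ [true]) =
          (MZV.shuffleWord (List.replicate p false ++ [true])
              (List.replicate 0 false ++ [true])).map (List.cons false) ++
            [true :: (List.replicate (p + 1) false ++ [true])] := rfl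
      rw [hsplit, List.map_append, List.sum_append, List.map_map,
        shuffleDepthOne_sum_map_shuffleWord n (f ∘ List.cons false) p 0 (by omega),
        Finset.Nat.sum_antidiagonal_succ]
      simp only [List.map_cons, List.map_nil, List.sum_cons, List.sum_nil, add_zero,
        Finset.Nat.antidiagonal_zero, Finset.sum_singleton, zero_add, Nat.choose_zero_right,
        Nat.choose_self, Nat.cast_one, one_mul, Function.comp_apply, List.replicate_zero,
        List.replicate_succ, List.nil_append, List.cons_append,
        shuffleDepthOne_replicate_append_cons]
      ring
  | n + 1, f, p + 1, q + 1, h => by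
      -- `x₀u ш x₀v = x₀(u ш x₀v) + x₀(x₀u ш v)` and Pascal's rule
      have hsplit : MZV.shuffleWord (List.replicate (p + 1) false ++ [true])
          (List.replicate (q + 1) false ++ [true]) =
          (MZV.shuffleWord (List.replicate p false ++ [true])
              (List.replicate (q + 1) false ++ [true])).map (List.cons false) ++
            (MZV.shuffleWord (List.replicate (p + 1) false ++ [true])
              (List.replicate q false ++ [true])).map (List.cons false) := rfl
      rw [hsplit, List.map_append, List.sum_append, List.map_map, List.map_map,
        shuffleDepthOne_sum_map_shuffleWord n (f ∘ List.cons false) p (q + 1) (by omega),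
        shuffleDepthOne_sum_map_shuffleWord n (f ∘ List.cons false) (p + 1) q (by omega)]
      have hu := shuffleDepthOne_pascal (fun x : ℕ × ℕ => f (List.replicate x.1 false ++
        (List.replicate (q + 1) false ++ true :: (List.replicate x.2 false ++ [true])))) p q
      have hv := shuffleDepthOne_pascal (fun y : ℕ × ℕ => f (List.replicate y.1 false ++
        (List.replicate (p + 1) false ++ true :: (List.replicate y.2 false ++ [true])))) q p
      simp only [Function.comp_apply, List.replicate_succ, List.cons_append,
        shuffleDepthOne_replicate_append_cons] at hu hv ⊢
      linear_combination hu + hv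

/-- **Stub (i) — Euler's decomposition for group-like series**: the shuffle product of two
depth-one words `x₀^{a-1}x₁ ш x₀^{b-1}x₁` counted with binomial multiplicities,
`c_{(a)} c_{(b)} = Σ_{i<a} C(b-1+i, i) c_{(b+i, a-i)} + Σ_{j<b} C(a-1+j, j) c_{(a+j, b-j)}` for
every group-like `φ ∈ R⟨⟨x₀, x₁⟩⟩` and `a, b ≥ 1` (at `Φ_KZ` and `a, b ≥ 2` this is Euler's
decomposition `ζ(a)ζ(b) = Σ …`, tree theorem `multipleZeta_mul_eq_euler_decomposition` for real
MZVs; e.g. `c_{x₀x₁}² = 2 c_{x₀x₁x₀x₁} + 4 c_{x₀x₀x₁x₁}`). [cite: IharaKanekoZagier2006, §2] -/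
theorem stub_shuffleDepthOne :
    ∀ (R : Type) [CommRing R] (φ : NCSeries Bool R), NCSeries.IsGroupLike φ →
      ∀ a b : ℕ, 1 ≤ a → 1 ≤ b →
        φ (MZV.binaryWord [a]) * φ (MZV.binaryWord [b]) =
          ∑ i ∈ Finset.range a, ((b - 1 + i).choose i : R) * φ (MZV.binaryWord [b + i, a - i]) +
            ∑ j ∈ Finset.range b, ((a - 1 + j).choose j : R) * φ (MZV.binaryWord [a + j, b - j]) := by
  intro R _ φ hφ a b ha hb
  obtain ⟨p, rfl⟩ : ∃ p, a = p + 1 := ⟨a - 1, by omega⟩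
  obtain ⟨q, rfl⟩ : ∃ q, b = q + 1 := ⟨b - 1, by omega⟩
  have h1 : MZV.binaryWord [p + 1] = List.replicate p false ++ [true] := by
    simp [MZV.binaryWord]
  have h2 : MZV.binaryWord [q + 1] = List.replicate q false ++ [true] := by
    simp [MZV.binaryWord]
  rw [hφ.mul_eq_sum_shuffleWord, h1, h2, shuffleDepthOne_sum_map_shuffleWord (p + q) φ p q rfl,
    Finset.Nat.sum_antidiagonal_eq_sum_range_succ_mk,
    Finset.Nat.sum_antidiagonal_eq_sum_range_succ_mk]
  congr 1
  · refine Finset.sum_congr rfl fun i hi => ?_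
    have hi' : i < p + 1 := Finset.mem_range.1 hi
    rw [Nat.add_sub_cancel, show q + 1 + i = (i + q) + 1 by omega,
      show p + 1 - i = (p - i) + 1 by omega]
    simp only [MZV.binaryWord, Nat.add_sub_cancel, List.append_assoc, List.singleton_append,
      List.append_nil, List.replicate_add]
  · refine Finset.sum_congr rfl fun j hj => ?_
    have hj' : j < q + 1 := Finset.mem_range.1 hj
    rw [Nat.add_sub_cancel, show p + 1 + j = (j + p) + 1 by omega,
      show q + 1 - j = (q - j) + 1 by omega]
    simp only [MZV.binaryWord, Nat.add_sub_cancel, List.append_assoc, List.singleton_append,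
      List.append_nil, List.replicate_add]

end Summit.KontsevichZagierPeriods.FurushoPentagon.KernelModuloPeriodConjecture
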